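import Summits.Ventures.PercRepro.Night2ExcessMass

/-!
# PercRepro — the `(7, 5)` cells `(2, 1)` and `(2, 0)` in the per-basis excess regime (night-2, gen 20)

`Night2PartialCells` closed `(2, 1)` with `m₁ = 7` and `(2, 0)` with `m₁ = 6` (every non-basis thin member misses
`≥ m₁` points).  With the per-basis excess bound (chord of `1/(m + 2)` over `2 ≤ m ≤ n − ρ + 1`) the target sums
hold with `m₁ = 5` at `(2, 1)` for `9 ≤ n = |G| − 1 ≤ 13` and with `m₁ = 4` at `(2, 0)` for `10 ≤ n = |G| ≤ 13`,
while the crude bounds `ρ λ` suffice with the same `m₁` for `n ≥ 14` (`61 C(n, 5) ≤ 8 A + 72 T`, resp.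
`27 C(n, 6) ≤ 8 A + 36 T`: bounded ranges by kernel evaluation, growth from `n ≥ 21`, resp. `n ≥ 17`).
**`localShadowHall_two_one_five_of_excess`** (`m₁ = 5`) and **`localShadowHall_two_zero_five_of_excess`**
(`m₁ = 4`): (LI_G) at the two cells with no size bound.
-/

namespace PercRepro.Shadow

open Finset PerFlat ThmH

namespace DGenP

/-! ## The cell `(2, 1)` with `m₁ = 5` -/

/-- The chord of `1/(m + 2)` over `2 ≤ m ≤ 5` (cell `(2, 1)`, `n = 9`). -/
theorem chord_two_one_9 : ∀ m : ℕ, 2 ≤ m → m ≤ 5 →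
    1 / ((m : ℚ) + ((2 : ℕ) : ℚ)) ≤ (9 / 28 : ℚ) - (1 / 28 : ℚ) * (m : ℚ) := by
  intro m h1 h2
  interval_cases m <;> norm_num

/-- `excessBound = 13/18` at `(2, 1)`, `n = 9`. -/
theorem excessBound_two_one_9 : excessBound 5 2 5 1 9 (9 / 28 : ℚ) (1 / 28 : ℚ) = (13 / 18 : ℚ) := by
  unfold excessBound capDG phiQ; norm_num

/-- The target sum of the cell `(2, 1)` at `n = 9` with `m₁ = 5`: `13/18 · C(9, 5) ≤ c′ A + T` with `A = 0`, `T = 130`. -/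
theorem sum_two_one_9_m5 : 1 ≤ DGenP.genSum 9 5 4 (cPrimeDGP 5 2 5 1 5)
    (excessBound 5 2 5 1 9 (9 / 28 : ℚ) (1 / 28 : ℚ) / ((5 : ℕ) : ℚ)) := by
  have hc : cPrimeDGP 5 2 5 1 5 = (1 / 9 : ℚ) := by unfold cPrimeDGP capDG reqDGP phiQ; norm_num
  have hA : DGen.Aρt 9 5 4 = 0 := by decide
  have hT : DGen.Ttop 9 4 = 130 := by decide
  have hC : Nat.choose 9 5 = 126 := by decide
  rw [excessBound_two_one_9, hc, DGenP.genSum_eq (by norm_num) (by norm_num) (by norm_num), hA, hT, hC]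
  norm_num

/-- The chord of `1/(m + 2)` over `2 ≤ m ≤ 6` (cell `(2, 1)`, `n = 10`). -/
theorem chord_two_one_10 : ∀ m : ℕ, 2 ≤ m → m ≤ 6 →
    1 / ((m : ℚ) + ((2 : ℕ) : ℚ)) ≤ (5 / 16 : ℚ) - (1 / 32 : ℚ) * (m : ℚ) := by
  intro m h1 h2
  interval_cases m <;> norm_num

/-- `excessBound = 383/576` at `(2, 1)`, `n = 10`. -/
theorem excessBound_two_one_10 : excessBound 5 2 5 1 10 (5 / 16 : ℚ) (1 / 32 : ℚ) = (383 / 576 : ℚ) := by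
  unfold excessBound capDG phiQ; norm_num

/-- The target sum of the cell `(2, 1)` at `n = 10` with `m₁ = 5`: `383/576 · C(10, 5) ≤ c′ A + T` with `A = 210`, `T = 176`. -/
theorem sum_two_one_10_m5 : 1 ≤ DGenP.genSum 10 5 4 (cPrimeDGP 5 2 5 1 5)
    (excessBound 5 2 5 1 10 (5 / 16 : ℚ) (1 / 32 : ℚ) / ((5 : ℕ) : ℚ)) := by
  have hc : cPrimeDGP 5 2 5 1 5 = (1 / 9 : ℚ) := by unfold cPrimeDGP capDG reqDGP phiQ; norm_num
  have hA : DGen.Aρt 10 5 4 = 210 := by decide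
  have hT : DGen.Ttop 10 4 = 176 := by decide
  have hC : Nat.choose 10 5 = 252 := by decide
  rw [excessBound_two_one_10, hc, DGenP.genSum_eq (by norm_num) (by norm_num) (by norm_num), hA, hT, hC]
  norm_num

/-- The chord of `1/(m + 2)` over `2 ≤ m ≤ 7` (cell `(2, 1)`, `n = 11`). -/
theorem chord_two_one_11 : ∀ m : ℕ, 2 ≤ m → m ≤ 7 →
    1 / ((m : ℚ) + ((2 : ℕ) : ℚ)) ≤ (11 / 36 : ℚ) - (1 / 36 : ℚ) * (m : ℚ) := by
  intro m h1 h2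
  interval_cases m <;> norm_num

/-- `excessBound = 67/108` at `(2, 1)`, `n = 11`. -/
theorem excessBound_two_one_11 : excessBound 5 2 5 1 11 (11 / 36 : ℚ) (1 / 36 : ℚ) = (67 / 108 : ℚ) := by
  unfold excessBound capDG phiQ; norm_num

/-- The target sum of the cell `(2, 1)` at `n = 11` with `m₁ = 5`: `67/108 · C(11, 5) ≤ c′ A + T` with `A = 792`, `T = 232`. -/
theorem sum_two_one_11_m5 : 1 ≤ DGenP.genSum 11 5 4 (cPrimeDGP 5 2 5 1 5)
    (excessBound 5 2 5 1 11 (11 / 36 : ℚ) (1 / 36 : ℚ) / ((5 : ℕ) : ℚ)) := by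
  have hc : cPrimeDGP 5 2 5 1 5 = (1 / 9 : ℚ) := by unfold cPrimeDGP capDG reqDGP phiQ; norm_num
  have hA : DGen.Aρt 11 5 4 = 792 := by decide
  have hT : DGen.Ttop 11 4 = 232 := by decide
  have hC : Nat.choose 11 5 = 462 := by decide
  rw [excessBound_two_one_11, hc, DGenP.genSum_eq (by norm_num) (by norm_num) (by norm_num), hA, hT, hC]
  norm_num

/-- The chord of `1/(m + 2)` over `2 ≤ m ≤ 8` (cell `(2, 1)`, `n = 12`). -/
theorem chord_two_one_12 : ∀ m : ℕ, 2 ≤ m → m ≤ 8 →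
    1 / ((m : ℚ) + ((2 : ℕ) : ℚ)) ≤ (3 / 10 : ℚ) - (1 / 40 : ℚ) * (m : ℚ) := by
  intro m h1 h2
  interval_cases m <;> norm_num

/-- `excessBound = 421/720` at `(2, 1)`, `n = 12`. -/
theorem excessBound_two_one_12 : excessBound 5 2 5 1 12 (3 / 10 : ℚ) (1 / 40 : ℚ) = (421 / 720 : ℚ) := by
  unfold excessBound capDG phiQ; norm_num

/-- The target sum of the cell `(2, 1)` at `n = 12` with `m₁ = 5`: `421/720 · C(12, 5) ≤ c′ A + T` with `A = 2211`, `T = 299`. -/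
theorem sum_two_one_12_m5 : 1 ≤ DGenP.genSum 12 5 4 (cPrimeDGP 5 2 5 1 5)
    (excessBound 5 2 5 1 12 (3 / 10 : ℚ) (1 / 40 : ℚ) / ((5 : ℕ) : ℚ)) := by
  have hc : cPrimeDGP 5 2 5 1 5 = (1 / 9 : ℚ) := by unfold cPrimeDGP capDG reqDGP phiQ; norm_num
  have hA : DGen.Aρt 12 5 4 = 2211 := by decide
  have hT : DGen.Ttop 12 4 = 299 := by decide
  have hC : Nat.choose 12 5 = 792 := by decide
  rw [excessBound_two_one_12, hc, DGenP.genSum_eq (by norm_num) (by norm_num) (by norm_num), hA, hT, hC]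
  norm_num

/-- The chord of `1/(m + 2)` over `2 ≤ m ≤ 9` (cell `(2, 1)`, `n = 13`). -/
theorem chord_two_one_13 : ∀ m : ℕ, 2 ≤ m → m ≤ 9 →
    1 / ((m : ℚ) + ((2 : ℕ) : ℚ)) ≤ (13 / 44 : ℚ) - (1 / 44 : ℚ) * (m : ℚ) := by
  intro m h1 h2
  interval_cases m <;> norm_num

/-- `excessBound = 5/9` at `(2, 1)`, `n = 13`. -/
theorem excessBound_two_one_13 : excessBound 5 2 5 1 13 (13 / 44 : ℚ) (1 / 44 : ℚ) = (5 / 9 : ℚ) := by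
  unfold excessBound capDG phiQ; norm_num

/-- The target sum of the cell `(2, 1)` at `n = 13` with `m₁ = 5`: `5/9 · C(13, 5) ≤ c′ A + T` with `A = 5434`, `T = 378`. -/
theorem sum_two_one_13_m5 : 1 ≤ DGenP.genSum 13 5 4 (cPrimeDGP 5 2 5 1 5)
    (excessBound 5 2 5 1 13 (13 / 44 : ℚ) (1 / 44 : ℚ) / ((5 : ℕ) : ℚ)) := by
  have hc : cPrimeDGP 5 2 5 1 5 = (1 / 9 : ℚ) := by unfold cPrimeDGP capDG reqDGP phiQ; norm_num
  have hA : DGen.Aρt 13 5 4 = 5434 := by decide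
  have hT : DGen.Ttop 13 4 = 378 := by decide
  have hC : Nat.choose 13 5 = 1287 := by decide
  rw [excessBound_two_one_13, hc, DGenP.genSum_eq (by norm_num) (by norm_num) (by norm_num), hA, hT, hC]
  norm_num

/-- `c′ = 1/9` at `(q, d, ρ, k, m₁) = (5, 2, 5, 1, 5)`. -/
theorem cPrimeDGP_two_one_m5 : cPrimeDGP 5 2 5 1 5 = 1 / 9 := by
  unfold cPrimeDGP capDG reqDGP phiQ; norm_num

/-- `8 (C(n, 6) + C(n, 7)) ≥ 61 C(n, 5)` for `n ≥ 21`. -/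
theorem two_one_growth_m5 {n : ℕ} (hn : 21 ≤ n) : 61 * n.choose 5 ≤ 8 * (n.choose 6 + n.choose 7) := by
  obtain ⟨m, rfl⟩ : ∃ m, n = m + 21 := ⟨n - 21, by omega⟩
  have h6 := Nat.choose_succ_right_eq (m + 21) 5
  have h7 := Nat.choose_succ_right_eq (m + 21) 6
  rw [show m + 21 - 5 = m + 16 by omega] at h6
  rw [show m + 21 - 6 = m + 15 by omega] at h7
  have l6 : 16 * (m + 21).choose 5 ≤ 6 * (m + 21).choose 6 := by
    nlinarith [h6, Nat.zero_le ((m + 21).choose 5 * m)]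
  have l7 : 15 * (m + 21).choose 6 ≤ 7 * (m + 21).choose 7 := by
    nlinarith [h7, Nat.zero_le ((m + 21).choose 6 * m)]
  omega

/-- The bounded range `14 ≤ n ≤ 20` of the `(2, 1)` inequality with `m₁ = 5`. -/
theorem two_one_ineq_m5_small {n : ℕ} (hn : 14 ≤ n) (hn' : n ≤ 20) :
    61 * n.choose 5 ≤ 8 * DGen.Aρt n 5 4 + 72 * DGen.Ttop n 4 := by
  have hid : (∑ i ∈ Finset.range 6, n.choose i) + DGen.Aρt n 5 4 + DGen.Ttop n 4 = 2 ^ n :=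
    DGen.sum_range_add_Aρt_add_Ttop (by omega)
  have key : 61 * n.choose 5 + 8 * (∑ i ∈ Finset.range 6, n.choose i) ≤ 8 * 2 ^ n + 64 * DGen.Ttop n 4 := by
    unfold DGen.Ttop
    interval_cases n <;> decide
  omega

/-- **The `(2, 1)` inequality with `m₁ = 5`** `61 C(n, 5) ≤ 8 A + 72 T` for every `n ≥ 14`. -/
theorem two_one_ineq_m5 {n : ℕ} (hn : 14 ≤ n) : 61 * n.choose 5 ≤ 8 * DGen.Aρt n 5 4 + 72 * DGen.Ttop n 4 := by
  by_cases h : n ≤ 20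
  · exact two_one_ineq_m5_small hn h
  · push Not at h
    have hA : n.choose 6 + n.choose 7 ≤ DGen.Aρt n 5 4 := DGen.Aρt_ge_two (by omega)
    have h2 := two_one_growth_m5 (by omega : 21 ≤ n)
    omega

/-- The crude target sum of the cell `(2, 1)` with `m₁ = 5` is at least `1` for every `n ≥ 14`. -/
theorem one_le_genSum_two_one_m5 {n : ℕ} (hn : 14 ≤ n) :
    1 ≤ genSum n 5 4 (cPrimeDGP 5 2 5 1 5) (lambdaDG 5 2 5 1) := by
  rw [cPrimeDGP_two_one_m5, lambdaDG_two_one, genSum_eq (by omega) (by norm_num) (by norm_num)]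
  have hC : (0 : ℚ) < (n.choose 5 : ℚ) := by exact_mod_cast Nat.choose_pos (by omega)
  rw [le_div_iff₀ (by positivity)]
  have key' : (61 : ℚ) * (n.choose 5 : ℚ) ≤ 8 * (DGen.Aρt n 5 4 : ℚ) + 72 * (DGen.Ttop n 4 : ℚ) := by
    exact_mod_cast two_one_ineq_m5 hn
  norm_num
  linarith

/-! ## The cell `(2, 0)` with `m₁ = 4` -/

/-- The chord of `1/(m + 2)` over `2 ≤ m ≤ 5` (cell `(2, 0)`, `n = 10`). -/
theorem chord_two_zero_10 : ∀ m : ℕ, 2 ≤ m → m ≤ 5 →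
    1 / ((m : ℚ) + ((2 : ℕ) : ℚ)) ≤ (9 / 28 : ℚ) - (1 / 28 : ℚ) * (m : ℚ) := by
  intro m h1 h2
  interval_cases m <;> norm_num

/-- `excessBound = 2/3` at `(2, 0)`, `n = 10`. -/
theorem excessBound_two_zero_10 : excessBound 5 2 6 0 10 (9 / 28 : ℚ) (1 / 28 : ℚ) = (2 / 3 : ℚ) := by
  unfold excessBound capDG phiQ; norm_num

/-- The target sum of the cell `(2, 0)` at `n = 10` with `m₁ = 4`: `2/3 · C(10, 6) ≤ c′ A + T` with `A = 0`, `T = 176`. -/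
theorem sum_two_zero_10_m4 : 1 ≤ DGenP.genSum 10 6 4 (cPrimeDGP 5 2 6 0 4)
    (excessBound 5 2 6 0 10 (9 / 28 : ℚ) (1 / 28 : ℚ) / ((6 : ℕ) : ℚ)) := by
  have hc : cPrimeDGP 5 2 6 0 4 = (2 / 9 : ℚ) := by unfold cPrimeDGP capDG reqDGP phiQ; norm_num
  have hA : DGen.Aρt 10 6 4 = 0 := by decide
  have hT : DGen.Ttop 10 4 = 176 := by decide
  have hC : Nat.choose 10 6 = 210 := by decide
  rw [excessBound_two_zero_10, hc, DGenP.genSum_eq (by norm_num) (by norm_num) (by norm_num), hA, hT, hC]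
  norm_num

/-- The chord of `1/(m + 2)` over `2 ≤ m ≤ 6` (cell `(2, 0)`, `n = 11`). -/
theorem chord_two_zero_11 : ∀ m : ℕ, 2 ≤ m → m ≤ 6 →
    1 / ((m : ℚ) + ((2 : ℕ) : ℚ)) ≤ (5 / 16 : ℚ) - (1 / 32 : ℚ) * (m : ℚ) := by
  intro m h1 h2
  interval_cases m <;> norm_num

/-- `excessBound = 29/48` at `(2, 0)`, `n = 11`. -/
theorem excessBound_two_zero_11 : excessBound 5 2 6 0 11 (5 / 16 : ℚ) (1 / 32 : ℚ) = (29 / 48 : ℚ) := by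
  unfold excessBound capDG phiQ; norm_num

/-- The target sum of the cell `(2, 0)` at `n = 11` with `m₁ = 4`: `29/48 · C(11, 6) ≤ c′ A + T` with `A = 330`, `T = 232`. -/
theorem sum_two_zero_11_m4 : 1 ≤ DGenP.genSum 11 6 4 (cPrimeDGP 5 2 6 0 4)
    (excessBound 5 2 6 0 11 (5 / 16 : ℚ) (1 / 32 : ℚ) / ((6 : ℕ) : ℚ)) := by
  have hc : cPrimeDGP 5 2 6 0 4 = (2 / 9 : ℚ) := by unfold cPrimeDGP capDG reqDGP phiQ; norm_num
  have hA : DGen.Aρt 11 6 4 = 330 := by decide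
  have hT : DGen.Ttop 11 4 = 232 := by decide
  have hC : Nat.choose 11 6 = 462 := by decide
  rw [excessBound_two_zero_11, hc, DGenP.genSum_eq (by norm_num) (by norm_num) (by norm_num), hA, hT, hC]
  norm_num

/-- The chord of `1/(m + 2)` over `2 ≤ m ≤ 7` (cell `(2, 0)`, `n = 12`). -/
theorem chord_two_zero_12 : ∀ m : ℕ, 2 ≤ m → m ≤ 7 →
    1 / ((m : ℚ) + ((2 : ℕ) : ℚ)) ≤ (11 / 36 : ℚ) - (1 / 36 : ℚ) * (m : ℚ) := by
  intro m h1 h2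
  interval_cases m <;> norm_num

/-- `excessBound = 5/9` at `(2, 0)`, `n = 12`. -/
theorem excessBound_two_zero_12 : excessBound 5 2 6 0 12 (11 / 36 : ℚ) (1 / 36 : ℚ) = (5 / 9 : ℚ) := by
  unfold excessBound capDG phiQ; norm_num

/-- The target sum of the cell `(2, 0)` at `n = 12` with `m₁ = 4`: `5/9 · C(12, 6) ≤ c′ A + T` with `A = 1287`, `T = 299`. -/
theorem sum_two_zero_12_m4 : 1 ≤ DGenP.genSum 12 6 4 (cPrimeDGP 5 2 6 0 4)
    (excessBound 5 2 6 0 12 (11 / 36 : ℚ) (1 / 36 : ℚ) / ((6 : ℕ) : ℚ)) := by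
  have hc : cPrimeDGP 5 2 6 0 4 = (2 / 9 : ℚ) := by unfold cPrimeDGP capDG reqDGP phiQ; norm_num
  have hA : DGen.Aρt 12 6 4 = 1287 := by decide
  have hT : DGen.Ttop 12 4 = 299 := by decide
  have hC : Nat.choose 12 6 = 924 := by decide
  rw [excessBound_two_zero_12, hc, DGenP.genSum_eq (by norm_num) (by norm_num) (by norm_num), hA, hT, hC]
  norm_num

/-- The chord of `1/(m + 2)` over `2 ≤ m ≤ 8` (cell `(2, 0)`, `n = 13`). -/
theorem chord_two_zero_13 : ∀ m : ℕ, 2 ≤ m → m ≤ 8 →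
    1 / ((m : ℚ) + ((2 : ℕ) : ℚ)) ≤ (3 / 10 : ℚ) - (1 / 40 : ℚ) * (m : ℚ) := by
  intro m h1 h2
  interval_cases m <;> norm_num

/-- `excessBound = 31/60` at `(2, 0)`, `n = 13`. -/
theorem excessBound_two_zero_13 : excessBound 5 2 6 0 13 (3 / 10 : ℚ) (1 / 40 : ℚ) = (31 / 60 : ℚ) := by
  unfold excessBound capDG phiQ; norm_num

/-- The target sum of the cell `(2, 0)` at `n = 13` with `m₁ = 4`: `31/60 · C(13, 6) ≤ c′ A + T` with `A = 3718`, `T = 378`. -/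
theorem sum_two_zero_13_m4 : 1 ≤ DGenP.genSum 13 6 4 (cPrimeDGP 5 2 6 0 4)
    (excessBound 5 2 6 0 13 (3 / 10 : ℚ) (1 / 40 : ℚ) / ((6 : ℕ) : ℚ)) := by
  have hc : cPrimeDGP 5 2 6 0 4 = (2 / 9 : ℚ) := by unfold cPrimeDGP capDG reqDGP phiQ; norm_num
  have hA : DGen.Aρt 13 6 4 = 3718 := by decide
  have hT : DGen.Ttop 13 4 = 378 := by decide
  have hC : Nat.choose 13 6 = 1716 := by decide
  rw [excessBound_two_zero_13, hc, DGenP.genSum_eq (by norm_num) (by norm_num) (by norm_num), hA, hT, hC]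
  norm_num

/-- `c′ = 2/9` at `(q, d, ρ, k, m₁) = (5, 2, 6, 0, 4)`. -/
theorem cPrimeDGP_two_zero_m4 : cPrimeDGP 5 2 6 0 4 = 2 / 9 := by
  unfold cPrimeDGP capDG reqDGP phiQ; norm_num

/-- `8 (C(n, 7) + C(n, 8)) ≥ 27 C(n, 6)` for `n ≥ 17`. -/
theorem two_zero_growth_m4 {n : ℕ} (hn : 17 ≤ n) : 27 * n.choose 6 ≤ 8 * (n.choose 7 + n.choose 8) := by
  obtain ⟨m, rfl⟩ : ∃ m, n = m + 17 := ⟨n - 17, by omega⟩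
  have h7 := Nat.choose_succ_right_eq (m + 17) 6
  have h8 := Nat.choose_succ_right_eq (m + 17) 7
  rw [show m + 17 - 6 = m + 11 by omega] at h7
  rw [show m + 17 - 7 = m + 10 by omega] at h8
  have l7 : 11 * (m + 17).choose 6 ≤ 7 * (m + 17).choose 7 := by
    nlinarith [h7, Nat.zero_le ((m + 17).choose 6 * m)]
  have l8 : 10 * (m + 17).choose 7 ≤ 8 * (m + 17).choose 8 := by
    nlinarith [h8, Nat.zero_le ((m + 17).choose 7 * m)]
  omega

/-- The bounded range `14 ≤ n ≤ 16` of the `(2, 0)` inequality with `m₁ = 4`. -/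
theorem two_zero_ineq_m4_small {n : ℕ} (hn : 14 ≤ n) (hn' : n ≤ 16) :
    27 * n.choose 6 ≤ 8 * DGen.Aρt n 6 4 + 36 * DGen.Ttop n 4 := by
  have hid : (∑ i ∈ Finset.range 7, n.choose i) + DGen.Aρt n 6 4 + DGen.Ttop n 4 = 2 ^ n :=
    DGen.sum_range_add_Aρt_add_Ttop (by omega)
  have key : 27 * n.choose 6 + 8 * (∑ i ∈ Finset.range 7, n.choose i) ≤ 8 * 2 ^ n + 28 * DGen.Ttop n 4 := by
    unfold DGen.Ttop
    interval_cases n <;> decide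
  omega

/-- **The `(2, 0)` inequality with `m₁ = 4`** `27 C(n, 6) ≤ 8 A + 36 T` for every `n ≥ 14`. -/
theorem two_zero_ineq_m4 {n : ℕ} (hn : 14 ≤ n) : 27 * n.choose 6 ≤ 8 * DGen.Aρt n 6 4 + 36 * DGen.Ttop n 4 := by
  by_cases h : n ≤ 16
  · exact two_zero_ineq_m4_small hn h
  · push Not at h
    have hA : n.choose 7 + n.choose 8 ≤ DGen.Aρt n 6 4 := DGen.Aρt_ge_two (by omega)
    have h2 := two_zero_growth_m4 (by omega : 17 ≤ n)
    omega

/-- The crude target sum of the cell `(2, 0)` with `m₁ = 4` is at least `1` for every `n ≥ 14`. -/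
theorem one_le_genSum_two_zero_m4 {n : ℕ} (hn : 14 ≤ n) :
    1 ≤ genSum n 6 4 (cPrimeDGP 5 2 6 0 4) (lambdaDG 5 2 6 0) := by
  rw [cPrimeDGP_two_zero_m4, lambdaDG_two_zero, genSum_eq (by omega) (by norm_num) (by norm_num)]
  have hC : (0 : ℚ) < (n.choose 6 : ℚ) := by exact_mod_cast Nat.choose_pos (by omega)
  rw [le_div_iff₀ (by positivity)]
  have key' : (27 : ℚ) * (n.choose 6 : ℚ) ≤ 8 * (DGen.Aρt n 6 4 : ℚ) + 36 * (DGen.Ttop n 4 : ℚ) := by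
    exact_mod_cast two_zero_ineq_m4 hn
  norm_num
  linarith

end DGenP

variable {α : Type*} [DecidableEq α] {M : Matroid α} [M.Finite]

open DGenP in
open scoped Classical in
/-- **THE `(7, 5)` CELL `(2, 1)` IN THE `5`-PARTIAL-SPREAD REGIME**: every thin member with `|B ∖ K| ≥ 5` misses at
least `5` points of `G`. -/
theorem localShadowHall_two_one_five_of_excess {G : Finset α} (hG : G ∈ flatsQ M (5 + 1))
    (hd : (gr M \ G).card = 2) (hk : kColoops M G = 1)
    (hs : ∀ e ∈ gr M, ∀ f ∈ gr M, e ≠ f → rkN M {e, f} = 2) (hl : ∀ e ∈ gr M, M.Indep {e})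
    (hm₁ : ∀ B ∈ thinMembers M 5 G, 5 ≤ (B \ coloops M G).card → 5 ≤ (G \ clF M B).card) :
    LocalShadowHall M 5 G := by
  have hk' : kColoops M G + 5 = 5 + 1 := by omega
  have hc5 : 0 ≤ cPrimeDGP 5 2 5 (kColoops M G) 5 := by rw [hk]; unfold cPrimeDGP capDG reqDGP phiQ; norm_num
  by_cases hn9 : 9 ≤ G.card - kColoops M G
  · by_cases hn13 : G.card - kColoops M G ≤ 13
    · obtain ⟨n, hn⟩ : ∃ n, G.card - kColoops M G = n := ⟨_, rfl⟩
      have hn1' : 9 ≤ n := by omega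
      have hn2' : n ≤ 13 := by omega
      interval_cases n
      · exact localShadowHall_excess_of_sum (d := 2) (ρ := 5) (m₁ := 5) hG hd (by norm_num) hk' (by norm_num)
          (by omega) hs hl hc5 hm₁ (a := (9 / 28 : ℚ)) (b := (1 / 28 : ℚ)) (by norm_num)
          (by rw [hn]; intro m h1 h2; exact chord_two_one_9 m h1 (by omega))
          (by rw [hn, hk, excessBound_two_one_9]; norm_num) (by rw [hn, hk]; exact sum_two_one_9_m5)
      · exact localShadowHall_excess_of_sum (d := 2) (ρ := 5) (m₁ := 5) hG hd (by norm_num) hk' (by norm_num)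
          (by omega) hs hl hc5 hm₁ (a := (5 / 16 : ℚ)) (b := (1 / 32 : ℚ)) (by norm_num)
          (by rw [hn]; intro m h1 h2; exact chord_two_one_10 m h1 (by omega))
          (by rw [hn, hk, excessBound_two_one_10]; norm_num) (by rw [hn, hk]; exact sum_two_one_10_m5)
      · exact localShadowHall_excess_of_sum (d := 2) (ρ := 5) (m₁ := 5) hG hd (by norm_num) hk' (by norm_num)
          (by omega) hs hl hc5 hm₁ (a := (11 / 36 : ℚ)) (b := (1 / 36 : ℚ)) (by norm_num)
          (by rw [hn]; intro m h1 h2; exact chord_two_one_11 m h1 (by omega))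
          (by rw [hn, hk, excessBound_two_one_11]; norm_num) (by rw [hn, hk]; exact sum_two_one_11_m5)
      · exact localShadowHall_excess_of_sum (d := 2) (ρ := 5) (m₁ := 5) hG hd (by norm_num) hk' (by norm_num)
          (by omega) hs hl hc5 hm₁ (a := (3 / 10 : ℚ)) (b := (1 / 40 : ℚ)) (by norm_num)
          (by rw [hn]; intro m h1 h2; exact chord_two_one_12 m h1 (by omega))
          (by rw [hn, hk, excessBound_two_one_12]; norm_num) (by rw [hn, hk]; exact sum_two_one_12_m5)
      · exact localShadowHall_excess_of_sum (d := 2) (ρ := 5) (m₁ := 5) hG hd (by norm_num) hk' (by norm_num)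
          (by omega) hs hl hc5 hm₁ (a := (13 / 44 : ℚ)) (b := (1 / 44 : ℚ)) (by norm_num)
          (by rw [hn]; intro m h1 h2; exact chord_two_one_13 m h1 (by omega))
          (by rw [hn, hk, excessBound_two_one_13]; norm_num) (by rw [hn, hk]; exact sum_two_one_13_m5)
    · push Not at hn13
      exact localShadowHall_dgenP_of_sum (d := 2) (ρ := 5) (m₁ := 5) hG hd (by norm_num) hk'
        (by norm_num) (by omega) hs hl hc5 (by rw [hk, DGenP.lambdaDG_two_one]; norm_num) hm₁
        (by rw [hk] at hn13 ⊢; exact DGenP.one_le_genSum_two_one_m5 (by omega))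
  · -- fewer than 9 points off the coloops: there is no thin member at all
    exact localShadowHall_of_spread (ρ := 5) (m₀ := 8) hG hd (by norm_num) (by rw [hk])
      (fun B hB => absurd (thin_card_bound (ρ := 5) hG hd (by norm_num) (by rw [hk]) hB) (by omega))
      (by rw [hk]; unfold phiQ; norm_num)

open DGenP in
open scoped Classical in
/-- **THE `(7, 5)` CELL `(2, 0)` IN THE `4`-PARTIAL-SPREAD REGIME**: every thin member with `|B| ≥ 6` misses at
least `4` points of `G`. -/
theorem localShadowHall_two_zero_five_of_excess {G : Finset α} (hG : G ∈ flatsQ M (5 + 1))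
    (hd : (gr M \ G).card = 2) (hk : kColoops M G = 0)
    (hs : ∀ e ∈ gr M, ∀ f ∈ gr M, e ≠ f → rkN M {e, f} = 2) (hl : ∀ e ∈ gr M, M.Indep {e})
    (hm₁ : ∀ B ∈ thinMembers M 5 G, 6 ≤ (B \ coloops M G).card → 4 ≤ (G \ clF M B).card) :
    LocalShadowHall M 5 G := by
  have hk' : kColoops M G + 6 = 5 + 1 := by omega
  have hc4 : 0 ≤ cPrimeDGP 5 2 6 (kColoops M G) 4 := by rw [hk]; unfold cPrimeDGP capDG reqDGP phiQ; norm_num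
  by_cases hn10 : 10 ≤ G.card - kColoops M G
  · by_cases hn13 : G.card - kColoops M G ≤ 13
    · obtain ⟨n, hn⟩ : ∃ n, G.card - kColoops M G = n := ⟨_, rfl⟩
      have hn1' : 10 ≤ n := by omega
      have hn2' : n ≤ 13 := by omega
      interval_cases n
      · exact localShadowHall_excess_of_sum (d := 2) (ρ := 6) (m₁ := 4) hG hd (by norm_num) hk' (by norm_num)
          (by omega) hs hl hc4 hm₁ (a := (9 / 28 : ℚ)) (b := (1 / 28 : ℚ)) (by norm_num)
          (by rw [hn]; intro m h1 h2; exact chord_two_zero_10 m h1 (by omega))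
          (by rw [hn, hk, excessBound_two_zero_10]; norm_num) (by rw [hn, hk]; exact sum_two_zero_10_m4)
      · exact localShadowHall_excess_of_sum (d := 2) (ρ := 6) (m₁ := 4) hG hd (by norm_num) hk' (by norm_num)
          (by omega) hs hl hc4 hm₁ (a := (5 / 16 : ℚ)) (b := (1 / 32 : ℚ)) (by norm_num)
          (by rw [hn]; intro m h1 h2; exact chord_two_zero_11 m h1 (by omega))
          (by rw [hn, hk, excessBound_two_zero_11]; norm_num) (by rw [hn, hk]; exact sum_two_zero_11_m4)
      · exact localShadowHall_excess_of_sum (d := 2) (ρ := 6) (m₁ := 4) hG hd (by norm_num) hk' (by norm_num)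
          (by omega) hs hl hc4 hm₁ (a := (11 / 36 : ℚ)) (b := (1 / 36 : ℚ)) (by norm_num)
          (by rw [hn]; intro m h1 h2; exact chord_two_zero_12 m h1 (by omega))
          (by rw [hn, hk, excessBound_two_zero_12]; norm_num) (by rw [hn, hk]; exact sum_two_zero_12_m4)
      · exact localShadowHall_excess_of_sum (d := 2) (ρ := 6) (m₁ := 4) hG hd (by norm_num) hk' (by norm_num)
          (by omega) hs hl hc4 hm₁ (a := (3 / 10 : ℚ)) (b := (1 / 40 : ℚ)) (by norm_num)
          (by rw [hn]; intro m h1 h2; exact chord_two_zero_13 m h1 (by omega))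
          (by rw [hn, hk, excessBound_two_zero_13]; norm_num) (by rw [hn, hk]; exact sum_two_zero_13_m4)
    · push Not at hn13
      exact localShadowHall_dgenP_of_sum (d := 2) (ρ := 6) (m₁ := 4) hG hd (by norm_num) hk'
        (by norm_num) (by omega) hs hl hc4 (by rw [hk, DGenP.lambdaDG_two_zero]; norm_num) hm₁
        (by rw [hk] at hn13 ⊢; exact DGenP.one_le_genSum_two_zero_m4 (by omega))
  · -- fewer than 10 points off the coloops: there is no thin member at all
    exact localShadowHall_of_spread (ρ := 6) (m₀ := 5) hG hd (by norm_num) (by rw [hk])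
      (fun B hB => absurd (thin_card_bound (ρ := 6) hG hd (by norm_num) (by rw [hk]) hB) (by omega))
      (by rw [hk]; unfold phiQ; norm_num)

end PercRepro.Shadow
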